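import Summits.NavierStokesRegularity.FluidComputer.PalasekTowerBurgersLayerBounds
import Summits.NavierStokesRegularity.FluidComputer.PalasekTowerRegister

/-!
# The circulation of a Burgers vortex LAYER around a horizontal circle — a core-ledger read-out tool

Cell `ns-blowup`, seat `ns-blowup-ecbridge-4` (g6; D-0074 GROUP C «BRIDGE SUPPORT», stub `first_episode` of
the crux `EpisodeBase` = item stmt-NavierStokesRegularity-19179 of the route `PalasekTowerBreakdown`, line
`slot`; supports / evidence only, nothing claimed). Generic (all radii `ρ`, all layer parameters) companion
of `PalasekTowerBurgersLayerBounds.lean`, used by the read-out files of the crux idea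
«orthogonal-seed-contact-strain» (19179 evidence #47/#48): the level read as a Burgers vortex LAYER
`u = burgersLayer γ ν ΔU = (−γx₀, V(x₀), γx₂)` and the register's CORE LEDGER (`CoreLedger`: a `C¹`
closed loop of speed `≤ 8π/N_j` inside a ball of radius `1/N_j` with circulation `≥ c₁ N_j^{β−2}`) read
on the horizontal circle `γ_ρ(s) = (ρ cos 2πs, ρ sin 2πs, 0)`, `s ∈ [0, 1]`. Proved (theorems only):

* the circle's calculus: velocity `γ_ρ′(s) = (−2πρ sin 2πs, 2πρ cos 2πs, 0)`, `C¹`, closed, `‖γ_ρ(s)‖ = ρ`,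
  `‖γ_ρ′(s)‖ = 2πρ ≤ 8πρ` (`ρ ≥ 0`) — i.e. `γ_{1/N_j}` is `CoreLedger`-admissible about the origin;
* the circulation integrand `⟪u(γ_ρ(s)), γ_ρ′(s)⟫ = 2πγρ² sin cos + 2π (ρ cos)·V(ρ cos)` (at `2πs`) and,
  from `t·V(t) ≥ (ΔU/√π)(κt² − κ³t⁴/3)` (`mul_burgersLayerProfile_ge`), `cos⁴ ≤ cos²`,
  `∫₀¹ sin(2πs)cos(2πs) ds = 0`, `∫₀¹ cos²(2πs) ds = 1/2`, the CIRCULATION FLOOR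
  `circulation u γ_ρ ≥ π (ΔU/√π) κ ρ² (1 − κ²ρ²/3)` (`γ, ν > 0`, `ΔU ≥ 0`, any `ρ`; `κ = (γ/2ν)^{1/2}`);
* packaging: for ANY slice `v` and level `j`, a circulation floor `N_j^{β−2} ≤ circulation v γ_{1/N_j}`
  yields the `j`-clause of `CoreLedger` verbatim on every rigid schedule with a ball of nonnegative radius
  (`coreLedger_clause_of_circle`).

LABEL: MODEL-side calculus / register packaging. WHAT THIS IS NOT: not Navier–Stokes evidence — nothing
about any registered stage, `FirstEpisodeD`, `RungG 1`, `EpisodeBaseG` or blow-up. References: J. M. Burgers,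
Adv. Appl. Mech. 1 (1948) 171–199; S. Palasek, arXiv:2605.13827 §3.1 (the core ledger). [folklore] calculus.
-/

noncomputable section

namespace Summit.NavierStokesRegularity.FluidComputer.PalasekTowerClayBridge

open Set MeasureTheory Filter Topology Function Real intervalIntegral
open scoped ContDiff
open Literature.Analysis.FluidPDE

/-! ## §1 The horizontal circle of radius `ρ` -/

/-- The squared norm of a vector of `ℝ³` given by its three coordinates. [folklore] -/
theorem norm_vec3_sq (a b c : ℝ) :
    ‖(!₂[a, b, c] : EuclideanSpace ℝ (Fin 3))‖ ^ 2 = a ^ 2 + b ^ 2 + c ^ 2 := by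
  rw [EuclideanSpace.norm_sq_eq]
  simp [Fin.sum_univ_three]

/-- The circle in `smul` form: `γ_ρ(s) = (ρ cos 2πs)·e₀ + (ρ sin 2πs)·e₁`. [folklore] -/
theorem circle_eq (ρ : ℝ) :
    (fun s : ℝ => (!₂[ρ * Real.cos (2 * π * s), ρ * Real.sin (2 * π * s), 0] : EuclideanSpace ℝ (Fin 3))) =
      fun s : ℝ => (ρ * Real.cos (2 * π * s)) • (!₂[(1 : ℝ), 0, 0] : EuclideanSpace ℝ (Fin 3)) +
        (ρ * Real.sin (2 * π * s)) • (!₂[(0 : ℝ), 1, 0] : EuclideanSpace ℝ (Fin 3)) := by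
  funext s; ext i; fin_cases i <;> simp

/-- The circle's velocity in `smul` form. [folklore] -/
theorem circleVel_eq (ρ : ℝ) :
    (fun s : ℝ => (!₂[-(2 * π * ρ) * Real.sin (2 * π * s), (2 * π * ρ) * Real.cos (2 * π * s), 0] :
      EuclideanSpace ℝ (Fin 3))) =
      fun s : ℝ => (ρ * (-Real.sin (2 * π * s) * (2 * π))) • (!₂[(1 : ℝ), 0, 0] : EuclideanSpace ℝ (Fin 3)) +
        (ρ * (Real.cos (2 * π * s) * (2 * π))) • (!₂[(0 : ℝ), 1, 0] : EuclideanSpace ℝ (Fin 3)) := by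
  funext s; ext i; fin_cases i <;> simp <;> ring

/-- **Velocity of the circle**: `γ_ρ′(s) = (−2πρ sin 2πs, 2πρ cos 2πs, 0)`. [folklore] -/
theorem hasDerivAt_circle (ρ s : ℝ) :
    HasDerivAt (fun s : ℝ => (!₂[ρ * Real.cos (2 * π * s), ρ * Real.sin (2 * π * s), 0] :
        EuclideanSpace ℝ (Fin 3)))
      (!₂[-(2 * π * ρ) * Real.sin (2 * π * s), (2 * π * ρ) * Real.cos (2 * π * s), 0]) s := by
  have h2π : HasDerivAt (fun s : ℝ => 2 * π * s) (2 * π) s := by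
    simpa using (hasDerivAt_id s).const_mul (2 * π)
  have hc : HasDerivAt (fun s : ℝ => ρ * Real.cos (2 * π * s))
      (ρ * (-Real.sin (2 * π * s) * (2 * π))) s := (h2π.cos).const_mul _
  have hsn : HasDerivAt (fun s : ℝ => ρ * Real.sin (2 * π * s))
      (ρ * (Real.cos (2 * π * s) * (2 * π))) s := (h2π.sin).const_mul _
  have h := (hc.smul_const (!₂[(1 : ℝ), 0, 0] : EuclideanSpace ℝ (Fin 3))).add
    (hsn.smul_const (!₂[(0 : ℝ), 1, 0] : EuclideanSpace ℝ (Fin 3)))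
  have hval : (!₂[-(2 * π * ρ) * Real.sin (2 * π * s), (2 * π * ρ) * Real.cos (2 * π * s), 0] :
      EuclideanSpace ℝ (Fin 3)) =
      (ρ * (-Real.sin (2 * π * s) * (2 * π))) • (!₂[(1 : ℝ), 0, 0] : EuclideanSpace ℝ (Fin 3)) +
        (ρ * (Real.cos (2 * π * s) * (2 * π))) • (!₂[(0 : ℝ), 1, 0] : EuclideanSpace ℝ (Fin 3)) := by
    ext i; fin_cases i <;> simp <;> ring
  rw [circle_eq, hval]
  exact h

/-- `deriv γ_ρ = γ_ρ′`. [folklore] -/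
theorem deriv_circle (ρ : ℝ) :
    deriv (fun s : ℝ => (!₂[ρ * Real.cos (2 * π * s), ρ * Real.sin (2 * π * s), 0] :
        EuclideanSpace ℝ (Fin 3))) =
      fun s => !₂[-(2 * π * ρ) * Real.sin (2 * π * s), (2 * π * ρ) * Real.cos (2 * π * s), 0] :=
  funext fun s => (hasDerivAt_circle ρ s).deriv

/-- The circle is `C¹` (indeed smooth). [folklore] -/
theorem contDiff_circle (ρ : ℝ) :
    ContDiff ℝ 1 (fun s : ℝ => (!₂[ρ * Real.cos (2 * π * s), ρ * Real.sin (2 * π * s), 0] :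
      EuclideanSpace ℝ (Fin 3))) := by
  rw [circle_eq]
  fun_prop

/-- The circle's velocity is continuous. [folklore] -/
theorem continuous_circleVel (ρ : ℝ) :
    Continuous (fun s : ℝ => (!₂[-(2 * π * ρ) * Real.sin (2 * π * s), (2 * π * ρ) * Real.cos (2 * π * s), 0] :
      EuclideanSpace ℝ (Fin 3))) := by
  rw [circleVel_eq]
  fun_prop

/-- The circle is closed: `γ_ρ(0) = γ_ρ(1)`. [folklore] -/
theorem circle_closed (ρ : ℝ) :
    (!₂[ρ * Real.cos (2 * π * 0), ρ * Real.sin (2 * π * 0), 0] : EuclideanSpace ℝ (Fin 3)) =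
      !₂[ρ * Real.cos (2 * π * 1), ρ * Real.sin (2 * π * 1), 0] := by
  ext i; fin_cases i <;> simp

/-- `‖γ_ρ(s)‖ = ρ` for `ρ ≥ 0`. [folklore] -/
theorem norm_circle {ρ : ℝ} (hρ : 0 ≤ ρ) (s : ℝ) :
    ‖(!₂[ρ * Real.cos (2 * π * s), ρ * Real.sin (2 * π * s), 0] : EuclideanSpace ℝ (Fin 3))‖ = ρ := by
  have hsq : ‖(!₂[ρ * Real.cos (2 * π * s), ρ * Real.sin (2 * π * s), 0] : EuclideanSpace ℝ (Fin 3))‖ ^ 2 =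
      ρ ^ 2 := by
    rw [norm_vec3_sq]
    have := Real.cos_sq_add_sin_sq (2 * π * s)
    calc (ρ * Real.cos (2 * π * s)) ^ 2 + (ρ * Real.sin (2 * π * s)) ^ 2 + 0 ^ 2
        = ρ ^ 2 * (Real.cos (2 * π * s) ^ 2 + Real.sin (2 * π * s) ^ 2) := by ring
      _ = ρ ^ 2 := by rw [this, mul_one]
  exact (sq_eq_sq₀ (norm_nonneg _) hρ).1 hsq

/-- The circle lies in the closed ball of radius `ρ` about the origin (`ρ ≥ 0`). [folklore] -/
theorem circle_mem_closedBall {ρ : ℝ} (hρ : 0 ≤ ρ) (s : ℝ) :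
    (!₂[ρ * Real.cos (2 * π * s), ρ * Real.sin (2 * π * s), 0] : EuclideanSpace ℝ (Fin 3)) ∈
      Metric.closedBall (0 : EuclideanSpace ℝ (Fin 3)) ρ := by
  rw [Metric.mem_closedBall, dist_zero_right, norm_circle hρ]

/-- The speed of the circle: `‖γ_ρ′(s)‖ = 2πρ` (`ρ ≥ 0`). [folklore] -/
theorem norm_deriv_circle {ρ : ℝ} (hρ : 0 ≤ ρ) (s : ℝ) :
    ‖deriv (fun s : ℝ => (!₂[ρ * Real.cos (2 * π * s), ρ * Real.sin (2 * π * s), 0] :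
        EuclideanSpace ℝ (Fin 3))) s‖ = 2 * π * ρ := by
  rw [deriv_circle]
  have h2 : 0 ≤ 2 * π * ρ := by positivity
  have hsq : ‖(!₂[-(2 * π * ρ) * Real.sin (2 * π * s), (2 * π * ρ) * Real.cos (2 * π * s), 0] :
      EuclideanSpace ℝ (Fin 3))‖ ^ 2 = (2 * π * ρ) ^ 2 := by
    rw [norm_vec3_sq]
    have := Real.cos_sq_add_sin_sq (2 * π * s)
    calc (-(2 * π * ρ) * Real.sin (2 * π * s)) ^ 2 + (2 * π * ρ * Real.cos (2 * π * s)) ^ 2 + 0 ^ 2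
        = (2 * π * ρ) ^ 2 * (Real.cos (2 * π * s) ^ 2 + Real.sin (2 * π * s) ^ 2) := by ring
      _ = (2 * π * ρ) ^ 2 := by rw [this, mul_one]
  exact (sq_eq_sq₀ (norm_nonneg _) h2).1 hsq

/-- The circle of radius `ρ` has speed `≤ 8πρ`: `CoreLedger`-admissible at `ρ = 1/N_j`. [folklore] -/
theorem norm_deriv_circle_le {ρ : ℝ} (hρ : 0 ≤ ρ) (s : ℝ) :
    ‖deriv (fun s : ℝ => (!₂[ρ * Real.cos (2 * π * s), ρ * Real.sin (2 * π * s), 0] :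
        EuclideanSpace ℝ (Fin 3))) s‖ ≤ 8 * π * ρ := by
  rw [norm_deriv_circle hρ]
  nlinarith [Real.pi_pos]

/-! ## §2 The circulation of the layer around the circle -/

/-- `∫₀¹ sin(2πs) cos(2πs) ds = 0`. [folklore] -/
theorem integral_sin_two_pi_mul_cos_two_pi_mul :
    ∫ s in (0 : ℝ)..1, Real.sin (2 * π * s) * Real.cos (2 * π * s) = 0 := by
  have h := intervalIntegral.integral_comp_mul_left (a := (0 : ℝ)) (b := 1)
    (fun x : ℝ => Real.sin x * Real.cos x) (c := 2 * π) (by positivity)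
  simp only [mul_zero, mul_one] at h
  rw [h, integral_sin_mul_cos₁]
  simp

/-- `∫₀¹ cos²(2πs) ds = 1/2`. [folklore] -/
theorem integral_cos_two_pi_mul_sq : ∫ s in (0 : ℝ)..1, Real.cos (2 * π * s) ^ 2 = 1 / 2 := by
  have h := intervalIntegral.integral_comp_mul_left (a := (0 : ℝ)) (b := 1)
    (fun x : ℝ => Real.cos x ^ 2) (c := 2 * π) (by positivity)
  simp only [mul_zero, mul_one] at h
  rw [h, integral_cos_sq, smul_eq_mul]
  have hπ : (2 : ℝ) * π ≠ 0 := by positivity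
  calc (2 * π)⁻¹ * ((Real.cos (2 * π) * Real.sin (2 * π) - Real.cos 0 * Real.sin 0 + 2 * π - 0) / 2)
      = (2 * π)⁻¹ * (2 * π) / 2 := by rw [Real.sin_two_pi, Real.sin_zero]; ring
    _ = 1 / 2 := by rw [inv_mul_cancel₀ hπ]

/-- **The circulation integrand of the layer on the circle**:
`⟪u(γ_ρ(s)), γ_ρ′(s)⟫ = 2πγρ² sin cos + 2π (ρ cos)·V(ρ cos)` (arguments `2πs`). [folklore] -/
theorem circulation_integrand_circle (γ ν ΔU ρ s : ℝ) :
    inner ℝ (burgersLayer γ ν ΔU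
        (!₂[ρ * Real.cos (2 * π * s), ρ * Real.sin (2 * π * s), 0] : EuclideanSpace ℝ (Fin 3)))
      (deriv (fun s : ℝ => (!₂[ρ * Real.cos (2 * π * s), ρ * Real.sin (2 * π * s), 0] :
        EuclideanSpace ℝ (Fin 3))) s) =
      2 * π * γ * ρ ^ 2 * (Real.sin (2 * π * s) * Real.cos (2 * π * s)) +
      2 * π * (ρ * Real.cos (2 * π * s) * burgersLayerProfile γ ν ΔU (ρ * Real.cos (2 * π * s))) := by
  rw [deriv_circle]
  simp [PiLp.inner_apply, Fin.sum_univ_three, burgersLayer_apply_zero, burgersLayer_apply_one,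
    burgersLayer_apply_two]
  ring

/-- A continuous minorant of the integrand: with `κ` the layer rate,
`⟪u(γ_ρ(s)), γ_ρ′(s)⟫ ≥ 2πγρ² sin cos + 2π(ΔU/√π) κρ²(1 − κ²ρ²/3) cos²` (`γ, ν > 0`, `ΔU ≥ 0`;
`t·V(t) ≥ (ΔU/√π)(κt² − κ³t⁴/3)` and `cos⁴ ≤ cos²`). [folklore] -/
theorem circulation_integrand_circle_ge {γ ν ΔU : ℝ} (hγ : 0 < γ) (hν : 0 < ν) (hΔU : 0 ≤ ΔU)
    (ρ s : ℝ) :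
    2 * π * γ * ρ ^ 2 * (Real.sin (2 * π * s) * Real.cos (2 * π * s)) +
      2 * π * (ΔU / Real.sqrt Real.pi * (burgersLayerRate γ ν * ρ ^ 2 *
        (1 - burgersLayerRate γ ν ^ 2 * ρ ^ 2 / 3))) * Real.cos (2 * π * s) ^ 2 ≤
      inner ℝ (burgersLayer γ ν ΔU
        (!₂[ρ * Real.cos (2 * π * s), ρ * Real.sin (2 * π * s), 0] : EuclideanSpace ℝ (Fin 3)))
      (deriv (fun s : ℝ => (!₂[ρ * Real.cos (2 * π * s), ρ * Real.sin (2 * π * s), 0] :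
        EuclideanSpace ℝ (Fin 3))) s) := by
  rw [circulation_integrand_circle]
  set κ := burgersLayerRate γ ν with hκ
  set c := Real.cos (2 * π * s) with hc
  have hmain := mul_burgersLayerProfile_ge hγ hν hΔU (ρ * c)
  rw [← hκ] at hmain
  have hc2 : c ^ 2 ≤ 1 := by rw [hc]; exact Real.cos_sq_le_one _
  have hc4 : c ^ 4 ≤ c ^ 2 := by nlinarith [sq_nonneg c]
  have hD : 0 ≤ ΔU / Real.sqrt Real.pi := by
    have : 0 < Real.sqrt Real.pi := Real.sqrt_pos.2 Real.pi_pos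
    exact div_nonneg hΔU this.le
  have hκ0 : 0 ≤ κ := Real.sqrt_nonneg _
  have hlow : ΔU / Real.sqrt Real.pi * (κ * ρ ^ 2 * (1 - κ ^ 2 * ρ ^ 2 / 3)) * c ^ 2 ≤
      ΔU / Real.sqrt Real.pi * (κ * (ρ * c) ^ 2 - κ ^ 3 * (ρ * c) ^ 4 / 3) := by
    have hk3 : 0 ≤ κ ^ 3 * ρ ^ 4 / 3 := by positivity
    have : κ * ρ ^ 2 * (1 - κ ^ 2 * ρ ^ 2 / 3) * c ^ 2 ≤ κ * (ρ * c) ^ 2 - κ ^ 3 * (ρ * c) ^ 4 / 3 := by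
      nlinarith [hk3, hc4]
    calc ΔU / Real.sqrt Real.pi * (κ * ρ ^ 2 * (1 - κ ^ 2 * ρ ^ 2 / 3)) * c ^ 2
        = ΔU / Real.sqrt Real.pi * (κ * ρ ^ 2 * (1 - κ ^ 2 * ρ ^ 2 / 3) * c ^ 2) := by ring
      _ ≤ _ := mul_le_mul_of_nonneg_left this hD
  nlinarith [hlow, hmain, Real.pi_pos]

/-- **Circulation floor of the layer on the circle**: for `γ, ν > 0`, `ΔU ≥ 0` and any radius `ρ`,
`circulation u γ_ρ ≥ π (ΔU/√π) κ ρ² (1 − κ²ρ²/3)` (by Stokes the exact value is the flux of the Gaussian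
vorticity sheet through the disc; this elementary minorant suffices for the register). [folklore] -/
theorem circulation_circle_ge {γ ν ΔU : ℝ} (hγ : 0 < γ) (hν : 0 < ν) (hΔU : 0 ≤ ΔU) (ρ : ℝ) :
    π * (ΔU / Real.sqrt Real.pi * (burgersLayerRate γ ν * ρ ^ 2 *
        (1 - burgersLayerRate γ ν ^ 2 * ρ ^ 2 / 3))) ≤
      circulation (burgersLayer γ ν ΔU)
        (fun s : ℝ => (!₂[ρ * Real.cos (2 * π * s), ρ * Real.sin (2 * π * s), 0] :
          EuclideanSpace ℝ (Fin 3))) := by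
  set κ := burgersLayerRate γ ν with hκ
  set β : ℝ := ΔU / Real.sqrt Real.pi * (κ * ρ ^ 2 * (1 - κ ^ 2 * ρ ^ 2 / 3)) with hβ
  set α : ℝ := 2 * π * γ * ρ ^ 2 with hα
  unfold circulation
  have hcont : Continuous fun s : ℝ => inner ℝ (burgersLayer γ ν ΔU
        (!₂[ρ * Real.cos (2 * π * s), ρ * Real.sin (2 * π * s), 0] : EuclideanSpace ℝ (Fin 3)))
      (deriv (fun s : ℝ => (!₂[ρ * Real.cos (2 * π * s), ρ * Real.sin (2 * π * s), 0] :
        EuclideanSpace ℝ (Fin 3))) s) := by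
    rw [deriv_circle]
    exact (((contDiff_burgersLayer γ ν ΔU).continuous).comp (contDiff_circle ρ).continuous).inner
      (continuous_circleVel ρ)
  have hlow_cont : Continuous fun s : ℝ =>
      α * (Real.sin (2 * π * s) * Real.cos (2 * π * s)) + 2 * π * β * Real.cos (2 * π * s) ^ 2 := by
    fun_prop
  have hmono : ∫ s in (0 : ℝ)..1,
      α * (Real.sin (2 * π * s) * Real.cos (2 * π * s)) + 2 * π * β * Real.cos (2 * π * s) ^ 2 ≤
      ∫ s in (0 : ℝ)..1, inner ℝ (burgersLayer γ ν ΔU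
        (!₂[ρ * Real.cos (2 * π * s), ρ * Real.sin (2 * π * s), 0] : EuclideanSpace ℝ (Fin 3)))
      (deriv (fun s : ℝ => (!₂[ρ * Real.cos (2 * π * s), ρ * Real.sin (2 * π * s), 0] :
        EuclideanSpace ℝ (Fin 3))) s) :=
    intervalIntegral.integral_mono_on zero_le_one (hlow_cont.intervalIntegrable _ _)
      (hcont.intervalIntegrable _ _) fun s _ => by
        have := circulation_integrand_circle_ge hγ hν hΔU ρ s
        rw [← hκ, ← hβ, ← hα] at this
        exact this
  have hval : ∫ s in (0 : ℝ)..1,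
      α * (Real.sin (2 * π * s) * Real.cos (2 * π * s)) + 2 * π * β * Real.cos (2 * π * s) ^ 2 =
      π * β := by
    rw [intervalIntegral.integral_add ((by fun_prop : Continuous fun s : ℝ =>
        α * (Real.sin (2 * π * s) * Real.cos (2 * π * s))).intervalIntegrable _ _)
      ((by fun_prop : Continuous fun s : ℝ => 2 * π * β * Real.cos (2 * π * s) ^ 2).intervalIntegrable _ _),
      intervalIntegral.integral_const_mul, intervalIntegral.integral_const_mul,
      integral_sin_two_pi_mul_cos_two_pi_mul, integral_cos_two_pi_mul_sq]
    ring
  rw [hval] at hmono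
  exact hmono

/-! ## §3 Packaging for the register's core ledger -/

/-- **From a circulation floor on the circle of radius `1/N_j` to the `j`-clause of `CoreLedger`.**
For ANY slice `v` (the register reads `v = u (τ j)`): if `N_j^{β−2} ≤ circulation v γ_{1/N_j}`, then on
every rigid schedule (so `c₁ = 1`) whose ball has nonnegative radius the loop `γ_{1/N_j}` — `C¹`, closed,
inside the closed ball of radius `1/N_j` about the origin, of speed `2π/N_j ≤ 8π/N_j` — witnesses the
clause. [cite: Palasek2026ElementaryModel, §3.1] -/
theorem coreLedger_clause_of_circle (S : Schedule TowerRates.wide) (hS : S.Rigid) (hr : 0 ≤ S.radius)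
    (v : EuclideanSpace ℝ (Fin 3) → EuclideanSpace ℝ (Fin 3)) (j : ℕ)
    (h : TowerRates.wide.N j ^ (TowerRates.wide.β - 2) ≤ circulation v
      (fun s : ℝ => (!₂[(1 / TowerRates.wide.N j) * Real.cos (2 * π * s),
        (1 / TowerRates.wide.N j) * Real.sin (2 * π * s), 0] : EuclideanSpace ℝ (Fin 3)))) :
    ∃ (x : EuclideanSpace ℝ (Fin 3)) (γ : ℝ → EuclideanSpace ℝ (Fin 3)),
      ‖x‖ ≤ S.radius ∧ ContDiff ℝ 1 γ ∧ γ 0 = γ 1 ∧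
      (∀ s ∈ Icc (0 : ℝ) 1, γ s ∈ Metric.closedBall x (1 / TowerRates.wide.N j)) ∧
      (∀ s ∈ Icc (0 : ℝ) 1, ‖deriv γ s‖ ≤ 8 * π / TowerRates.wide.N j) ∧
      S.c₁ * TowerRates.wide.N j ^ (TowerRates.wide.β - 2) ≤ circulation v γ := by
  have hρ : 0 ≤ 1 / TowerRates.wide.N j := (one_div_pos.2 (TowerRates.wide.N_pos j)).le
  refine ⟨0, fun s : ℝ => (!₂[(1 / TowerRates.wide.N j) * Real.cos (2 * π * s),
      (1 / TowerRates.wide.N j) * Real.sin (2 * π * s), 0] : EuclideanSpace ℝ (Fin 3)),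
    by rwa [norm_zero], contDiff_circle _, circle_closed _, fun s _ => circle_mem_closedBall hρ s,
    fun s _ => ?_, by rw [hS.c₁_eq, one_mul]; exact h⟩
  have := norm_deriv_circle_le hρ s
  rw [show 8 * π * (1 / TowerRates.wide.N j) = 8 * π / TowerRates.wide.N j by ring] at this
  exact this

end Summit.NavierStokesRegularity.FluidComputer.PalasekTowerClayBridge

end
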